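import Mathlib

/-!
# STUB-IDEAS `stub_cmLambdaLower` · k2 · gen 5 — typed sketch

Seat `planner-sidea-stub_cmLambdaLower-2-g5-0` (stub-ideation, k = 2, gen 5; technique: literature transfer /
typed dictionary; home family 2 = RESHAPE).  Card: `Cruxes/ResidualThetaCountLowerPureAtTwo/Ideas/stub-cmlambdalower-k2-g5.md`.

**BSD is NOT proved by anything here.**  RSL_g (`stmt-BirchSwinnertonDyer-22608`, the stub's statement by name) and
(R≥)ᵖ (`stmt-BirchSwinnertonDyer-26074`) stay OPEN.  Every declaration below is module / linear algebra or
arithmetic; nothing is asserted about any curve, modular form or Galois cohomology group.  0 `sorry`.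

Contents (section ↔ plan of the card):

* §A (PLAN 1 — *annihilator pair, not a Lagrangian*): `annLeft` (left annihilator under a pairing
  `M →ₗ N →ₗ P`), `map_annLeft_le_of_adjoint` (projection formula ⇒ corestriction maps annihilators into
  annihilators), `annLeft_iSup` (annihilator of a union), `annLeft_anti`, `annLeft_compr₂_of_injective` (k-direction);
  `two_mul_finrank_eq_of_orthogonal_eq_self` / `orthogonal_ne_self_of_two_mul_finrank_ne` /
  `orthogonal_ne_self_layer_two` (a self-orthogonal subspace of a non-degenerate space is half-dimensional;
  `3 ≠ 8/2`); `rA`, `rB`, `rA_add_rB`, `rA_lt_two_pow`, `rB_lt_two_pow`, `two_mul_r_ne_two_pow_succ`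
  (ℤ₂-ranks of the two signed subgroups of formal-group points along the cyclotomic ℤ₂-tower of ℚ₂: never
  half of `dim H¹(k_n, W[2]) = 2^(n+1)` from layer 2 on).
* §B (PLAN 2 — *(P-tie) ⊗ ℚ discharged: one rational line*): `exists_smul_eq_of_finrank_quotient_eq_one`,
  `add_comp_apply_eq_zero_of_anticomm` / `…_of_comm` (Kato's conjugation rule `z ∘ ι = ∓σ ∘ z` makes
  `(1 + σ) ∘ z` kill `(1 ± ι)V`), `exists_smul_eq_of_anticomm`; `subsingleton_baseChange_of_smul_eq_zero`,
  `finrank_baseChange_quotient_eq_of_smul_mem`, `finrank_baseChange_quot_span_eq_of_smul_eq` (the λ-currency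
  `dim_K (K ⊗_A (H ⧸ Λ z))` of the kit does not see WHICH non-zero-constant multiple of `z` is used).
* §C (PLAN 3 — *the `T = 0` pincer*, recorded with its obstruction): `associated_of_dvd_of_constantCoeff_dvd`.
-/

set_option linter.dupNamespace false

namespace Summit.BirchSwinnertonDyer.BirchSwinnertonDyer.Cruxes.ResidualThetaCountLowerPureAtTwo.StubIdeasK2G5

open Module

/-! ## §A  Annihilator pairs (PLAN 1) -/

section AnnihilatorPair

variable {R : Type*} [CommRing R]
variable {M N P : Type*} [AddCommGroup M] [AddCommGroup N] [AddCommGroup P]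
  [Module R M] [Module R N] [Module R P]

/-- The left annihilator of `S ≤ N` under a pairing `B : M →ₗ N →ₗ P` (model: the compact-side local condition
`H¹_{𝓕*}(k_n, T/ϖᵏ) := Ann(L⁺_{n,k})` DEFINING the dual Selmer structure, Mazur–Rubin 2004 §2.3 /
Howard 2004 Def. 2.1.10, as in the tree's `poitouTate_selmerStructure_duality`). -/
def annLeft (B : M →ₗ[R] N →ₗ[R] P) (S : Submodule R N) : Submodule R M where
  carrier := {m | ∀ n ∈ S, B m n = 0}
  add_mem' {a b} ha hb := fun n hn => by simp [map_add, ha n hn, hb n hn]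
  zero_mem' := fun n _ => by simp
  smul_mem' c {m} hm := fun n hn => by simp [map_smul, hm n hn]

@[simp] theorem mem_annLeft {B : M →ₗ[R] N →ₗ[R] P} {S : Submodule R N} {m : M} :
    m ∈ annLeft B S ↔ ∀ n ∈ S, B m n = 0 := Iff.rfl

theorem annLeft_anti (B : M →ₗ[R] N →ₗ[R] P) {S S' : Submodule R N} (h : S ≤ S') :
    annLeft B S' ≤ annLeft B S := fun _ hm n hn => hm n (h hn)

/-- **Annihilator of a union is the intersection of the annihilators** (the limit condition
`Ann(⋃ₙ res E⁺(kₙ) ⊗ ℚ₂/ℤ₂) = ⋂ₙ Ann(res E⁺(kₙ) ⊗ ℚ₂/ℤ₂)`, i.e. N1's kernel clause read layer by layer). -/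
theorem annLeft_iSup {ι : Sort*} (B : M →ₗ[R] N →ₗ[R] P) (S : ι → Submodule R N) :
    annLeft B (⨆ i, S i) = ⨅ i, annLeft B (S i) := by
  ext m
  simp only [mem_annLeft, Submodule.mem_iInf]
  constructor
  · exact fun h i n hn => h n (Submodule.mem_iSup_of_mem i hn)
  · intro h n hn
    have hle : (⨆ i, S i) ≤ LinearMap.ker (B m) :=
      iSup_le fun i n hn => LinearMap.mem_ker.2 (h i n hn)
    exact LinearMap.mem_ker.1 (hle hn)

/-- Enlarging the value module along an injection (`ℤ/2ᵏ ↪ ℤ/2ᵏ⁺¹`, the `k`-direction of the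
`(n,k)`-system) does not change annihilators. -/
theorem annLeft_compr₂_of_injective (B : M →ₗ[R] N →ₗ[R] P) {Q : Type*} [AddCommGroup Q] [Module R Q]
    (j : P →ₗ[R] Q) (hj : Function.Injective j) (S : Submodule R N) :
    annLeft (B.compr₂ j) S = annLeft B S := by
  ext m
  simp only [mem_annLeft, LinearMap.compr₂_apply]
  constructor
  · intro h n hn
    exact hj (by rw [map_zero]; exact h n hn)
  · intro h n hn
    rw [h n hn, map_zero]

variable {M₁ N₁ M₂ N₂ : Type*} [AddCommGroup M₁] [AddCommGroup N₁] [AddCommGroup M₂] [AddCommGroup N₂]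
  [Module R M₁] [Module R N₁] [Module R M₂] [Module R N₂]

/-- **Projection formula ⇒ corestriction respects annihilators.**  Two pairings `B₁` (layer `n`) and `B₂`
(layer `n+1`), maps `r = res : N₁ → N₂`, `c = cores : M₂ → M₁` with `B₁ (c m) n = B₂ m (r n)`
(Tate local duality: `⟨cores a, b⟩ₙ = ⟨a, res b⟩ₙ₊₁`); if `res` maps the layer-`n` condition into the
layer-`(n+1)` condition then `cores` maps `Ann(S₂)` into `Ann(S₁)` — so the compact-side conditions form an
inverse system WITHOUT any self-duality of the `Sᵢ`. -/
theorem map_annLeft_le_of_adjoint (B₁ : M₁ →ₗ[R] N₁ →ₗ[R] P) (B₂ : M₂ →ₗ[R] N₂ →ₗ[R] P)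
    (r : N₁ →ₗ[R] N₂) (c : M₂ →ₗ[R] M₁) (hadj : ∀ m n, B₁ (c m) n = B₂ m (r n))
    {S₁ : Submodule R N₁} {S₂ : Submodule R N₂} (hS : S₁.map r ≤ S₂) :
    (annLeft B₂ S₂).map c ≤ annLeft B₁ S₁ := by
  rintro _ ⟨m, hm, rfl⟩
  have hm' : ∀ n ∈ S₂, B₂ m n = 0 := hm
  show ∀ n ∈ S₁, B₁ (c m) n = 0
  intro n hn
  rw [hadj]
  exact hm' _ (hS (Submodule.mem_map_of_mem hn))

end AnnihilatorPair

section Lagrangian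

variable {K V : Type*} [Field K] [AddCommGroup V] [Module K V] [FiniteDimensional K V]

/-- A subspace equal to its own orthogonal under a non-degenerate bilinear form is half-dimensional. -/
theorem two_mul_finrank_eq_of_orthogonal_eq_self {B : LinearMap.BilinForm K V} (hB : B.Nondegenerate)
    (W : Submodule K V) (hW : B.orthogonal W = W) : 2 * finrank K W = finrank K V := by
  have h := LinearMap.BilinForm.finrank_orthogonal hB W
  rw [hW] at h
  have hle : finrank K W ≤ finrank K V := Submodule.finrank_le W
  omega

theorem orthogonal_ne_self_of_two_mul_finrank_ne {B : LinearMap.BilinForm K V} (hB : B.Nondegenerate)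
    (W : Submodule K V) (h : 2 * finrank K W ≠ finrank K V) : B.orthogonal W ≠ W :=
  fun hW => h (two_mul_finrank_eq_of_orthogonal_eq_self hB W hW)

/-- **Layer 2 of the 2-adic tower in numbers**: `dim_{𝔽₂} H¹(k₂, W[2]) = 2·[k₂:ℚ₂] = 8` (local Euler
characteristic, `W[2](k₂) = 0`), the signed Kummer subspace has dimension `rA 2 = 3`; `2·3 ≠ 8`, so it is NOT
its own annihilator under local Tate duality. -/
theorem orthogonal_ne_self_layer_two {B : LinearMap.BilinForm K V} (hB : B.Nondegenerate)
    (hV : finrank K V = 8) (W : Submodule K V) (hW : finrank K W = 3) : B.orthogonal W ≠ W :=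
  orthogonal_ne_self_of_two_mul_finrank_ne hB W (by omega)

end Lagrangian

section SignedRanks

/-- `rA n`, `rB n`: ℤ₂-ranks of the two signed (Kobayashi-type) subgroups of the formal-group points over the
`n`-th layer `kₙ` of the cyclotomic ℤ₂-extension of ℚ₂ (`[kₙ : ℚ₂] = 2ⁿ`, `rank Ê(kₙ) = 2ⁿ`): both contain
`Ê(ℚ₂)` (rank 1), and the new rank `2^m` acquired at layer `m+1` goes to the subgroup of the parity of `m+1`
(trace relations; tree: `Im P⁺_{2m} = ω̃⁻_{2m} Λ_{2m}`).  Which of the two is called "plus" is a convention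
(swapped at `p = 2` relative to odd `p`: Kurihara–Otsuki 2006 Rem. 0.2(3), Rockwood 2022 §2). -/
def rA : ℕ → ℕ
  | 0 => 1
  | m + 1 => if (m + 1) % 2 = 0 then rA m + 2 ^ m else rA m

/-- See `rA`. -/
def rB : ℕ → ℕ
  | 0 => 1
  | m + 1 => if (m + 1) % 2 = 0 then rB m else rB m + 2 ^ m

/-- `E^A(kₙ) + E^B(kₙ) = Ê(kₙ)` and `E^A ∩ E^B = Ê(ℚ₂)` in ranks: `rA n + rB n = 2ⁿ + 1`. -/
theorem rA_add_rB (n : ℕ) : rA n + rB n = 2 ^ n + 1 := by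
  induction n with
  | zero => simp [rA, rB]
  | succ m ih =>
    simp only [rA, rB, pow_succ]
    split_ifs <;> omega

theorem two_le_rB : ∀ n, 1 ≤ n → 2 ≤ rB n := by
  intro n hn
  induction n with
  | zero => omega
  | succ m ih =>
    rcases Nat.eq_zero_or_pos m with rfl | hm
    · decide
    · have := ih hm
      have h2m : 1 ≤ 2 ^ m := Nat.one_le_two_pow
      simp only [rB]
      split_ifs <;> omega

theorem three_le_rA : ∀ n, 2 ≤ n → 3 ≤ rA n := by
  intro n hn
  induction n with
  | zero => omega
  | succ m ih =>
    rcases Nat.lt_or_ge m 2 with hm | hm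
    · interval_cases m
      · omega
      · decide
    · have := ih hm
      have h2m : 1 ≤ 2 ^ m := Nat.one_le_two_pow
      simp only [rA]
      split_ifs <;> omega

theorem rA_lt_two_pow (n : ℕ) (hn : 1 ≤ n) : rA n < 2 ^ n := by
  have h := rA_add_rB n
  have := two_le_rB n hn
  omega

theorem rB_lt_two_pow (n : ℕ) (hn : 2 ≤ n) : rB n < 2 ^ n := by
  have h := rA_add_rB n
  have := three_le_rA n hn
  omega

example : rA 1 = 1 ∧ rB 1 = 2 ∧ rA 2 = 3 ∧ rB 2 = 2 ∧ rA 3 = 3 ∧ rB 3 = 6 ∧ rA 4 = 11 ∧ rB 4 = 6 := by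
  decide

/-- **From layer 2 on, neither signed Kummer subspace of `H¹(kₙ, W[2])` (dimension `2^(n+1)`) is
half-dimensional**, hence (by `orthogonal_ne_self_of_two_mul_finrank_ne`) neither is its own annihilator under
local Tate duality: the finite-level "plus self-annihilation" of STUB-PLAN rev 5 §10.2(b)/§11 is false as stated
and — PLAN 1 — not needed. -/
theorem two_mul_r_ne_two_pow_succ (n : ℕ) (hn : 2 ≤ n) :
    2 * rA n ≠ 2 ^ (n + 1) ∧ 2 * rB n ≠ 2 ^ (n + 1) := by
  have h₁ := rA_lt_two_pow n (by omega)
  have h₂ := rB_lt_two_pow n hn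
  rw [pow_succ]
  omega

end SignedRanks

/-! ## §B  One rational line: (P-tie) ⊗ ℚ (PLAN 2) -/

section OneLine

variable {F : Type*} [Field F] {V H : Type*} [AddCommGroup V] [Module F V] [AddCommGroup H] [Module F H]

/-- A linear map killing a codimension-one subspace takes all its values on ONE line. (Model: Kato's
`F_λ`-linear `γ ↦ z_γ` — Kato 2004 Thm. 12.5(1), "there exists a unique `F_λ`-linear map
`V_{F_λ}(f) → 𝐇¹(V_{F_λ}(f))`" — composed with the projector to the even (`σ₋₁ = +1`) tower.) -/
theorem exists_smul_eq_of_finrank_quotient_eq_one (f : V →ₗ[F] H) (U : Submodule F V)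
    (hU : U ≤ LinearMap.ker f) (h1 : finrank F (V ⧸ U) = 1) {v₁ : V} (hv₁ : v₁ ∉ U) (v₂ : V) :
    ∃ e : F, f v₂ = e • f v₁ := by
  have hne : U.mkQ v₁ ≠ 0 := by
    simpa [Submodule.mkQ_apply, Submodule.Quotient.mk_eq_zero] using hv₁
  obtain ⟨e, he⟩ := (finrank_eq_one_iff_of_nonzero' (U.mkQ v₁) hne).1 h1 (U.mkQ v₂)
  refine ⟨e, ?_⟩
  have hq : U.mkQ (v₂ - e • v₁) = 0 := by
    rw [map_sub, map_smul, ← he, sub_self]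
  have hmem : v₂ - e • v₁ ∈ U := (Submodule.Quotient.mk_eq_zero U).1 hq
  have hker := hU hmem
  rw [LinearMap.mem_ker, map_sub, map_smul, sub_eq_zero] at hker
  exact hker

/-- **Kato's conjugation rule, sign `−`** (`z_{ι(γ)} = −σ₋₁(z_γ)`, Kato 2004 Thm. 12.5, p. 221): with
`σ² = 1`, `(1 + σ) ∘ z` kills `(1 + ι) V`. -/
theorem add_comp_apply_eq_zero_of_anticomm (z : V →ₗ[F] H) (ι : V →ₗ[F] V) (σ : H →ₗ[F] H)
    (hσ : σ ∘ₗ σ = LinearMap.id) (hz : ∀ v, z (ι v) = -σ (z v)) (v : V) :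
    z (v + ι v) + σ (z (v + ι v)) = 0 := by
  have hσσ : ∀ h, σ (σ h) = h := fun h => by
    simpa using LinearMap.congr_fun hσ h
  simp only [map_add, hz, map_neg, hσσ]
  abel

/-- Same with sign `+` (`z ∘ ι = σ ∘ z`): `(1 + σ) ∘ z` kills `(1 − ι) V`. -/
theorem add_comp_apply_eq_zero_of_comm (z : V →ₗ[F] H) (ι : V →ₗ[F] V) (σ : H →ₗ[F] H)
    (hσ : σ ∘ₗ σ = LinearMap.id) (hz : ∀ v, z (ι v) = σ (z v)) (v : V) :
    z (v - ι v) + σ (z (v - ι v)) = 0 := by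
  have hσσ : ∀ h, σ (σ h) = h := fun h => by
    simpa using LinearMap.congr_fun hσ h
  simp only [map_sub, hz, hσσ]
  abel

theorem range_add_le_ker_of_anticomm (z : V →ₗ[F] H) (ι : V →ₗ[F] V) (σ : H →ₗ[F] H)
    (hσ : σ ∘ₗ σ = LinearMap.id) (hz : ∀ v, z (ι v) = -σ (z v)) :
    LinearMap.range ((LinearMap.id : V →ₗ[F] V) + ι) ≤
      LinearMap.ker (((LinearMap.id : H →ₗ[F] H) + σ) ∘ₗ z) := by
  rintro _ ⟨v, rfl⟩
  rw [LinearMap.mem_ker, LinearMap.comp_apply, LinearMap.add_apply, LinearMap.id_apply,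
    LinearMap.add_apply, LinearMap.id_apply]
  exact add_comp_apply_eq_zero_of_anticomm z ι σ hσ hz v

/-- **(P-tie) ⊗ ℚ, abstract form.**  `z : V → H` linear, `z ∘ ι = −σ ∘ z`, `σ² = 1`, and `(1 + ι)V` of
codimension one (model: `V = V_{F_λ}(g)` two-dimensional and odd, `ι` = complex conjugation, `σ = σ₋₁`,
`H = 𝐇¹ ⊗ ℚ`): the even-tower components `z(γ) + σ z(γ)` of ALL zeta elements lie on the line through
`z(γ₁) + σ z(γ₁)` for any one `γ₁ ∉ (1 + ι)V` — so clause (i) may be imported for one `γ` and clause (ii) for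
another. -/
theorem exists_smul_eq_of_anticomm (z : V →ₗ[F] H) (ι : V →ₗ[F] V) (σ : H →ₗ[F] H)
    (hσ : σ ∘ₗ σ = LinearMap.id) (hz : ∀ v, z (ι v) = -σ (z v))
    (h1 : finrank F (V ⧸ LinearMap.range ((LinearMap.id : V →ₗ[F] V) + ι)) = 1)
    {γ₁ : V} (hγ₁ : γ₁ ∉ LinearMap.range ((LinearMap.id : V →ₗ[F] V) + ι)) (γ₂ : V) :
    ∃ e : F, z γ₂ + σ (z γ₂) = e • (z γ₁ + σ (z γ₁)) := by
  obtain ⟨e, he⟩ := exists_smul_eq_of_finrank_quotient_eq_one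
    (((LinearMap.id : H →ₗ[F] H) + σ) ∘ₗ z) _ (range_add_le_ker_of_anticomm z ι σ hσ hz) h1 hγ₁ γ₂
  refine ⟨e, ?_⟩
  simpa only [LinearMap.comp_apply, LinearMap.add_apply, LinearMap.id_apply] using he

end OneLine

section Currency

open TensorProduct

variable {A : Type*} [CommRing A] (K : Type*) [Field K] [Algebra A K]
variable {Λ : Type*} [CommRing Λ] [Algebra A Λ]
variable {H : Type*} [AddCommGroup H] [Module Λ H] [Module A H] [IsScalarTower A Λ H]

/-- An `A`-module killed by an element that becomes invertible in `K` dies after `K ⊗_A ·`. -/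
theorem subsingleton_baseChange_of_smul_eq_zero {N : Type*} [AddCommGroup N] [Module A N] {a : A}
    (ha : IsUnit (algebraMap A K a)) (hN : ∀ x : N, a • x = 0) : Subsingleton (K ⊗[A] N) := by
  obtain ⟨u, hu⟩ := ha
  have h0 : ∀ x : K ⊗[A] N, x = 0 := by
    intro x
    induction x using TensorProduct.induction_on with
    | zero => rfl
    | tmul k n =>
      have hk : k = a • (k * ↑u⁻¹) := by
        rw [Algebra.smul_def, ← hu, mul_left_comm, Units.mul_inv, mul_one]
      rw [hk, TensorProduct.smul_tmul, hN, TensorProduct.tmul_zero]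
    | add x y hx hy => rw [hx, hy, add_zero]
  exact ⟨fun x y => by rw [h0 x, h0 y]⟩

/-- **Core of the λ-invisibility of constants for quotients**: `S ≤ T` Λ-submodules of `H` with `a • T ⊆ S`
for some `a ∈ A` invertible in `K`; then `dim_K (K ⊗_A H/S) = dim_K (K ⊗_A H/T)`. -/
theorem finrank_baseChange_quotient_eq_of_smul_mem {S T : Submodule Λ H} (hST : S ≤ T) {a : A}
    (ha : IsUnit (algebraMap A K a)) (haT : ∀ t ∈ T, a • t ∈ S) :
    finrank K (K ⊗[A] (H ⧸ S)) = finrank K (K ⊗[A] (H ⧸ T)) := by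
  set N' : Submodule Λ (H ⧸ S) := T.map S.mkQ with hN'
  let g₀ : (H ⧸ S) →ₗ[Λ] (H ⧸ T) := S.liftQ T.mkQ (by rw [Submodule.ker_mkQ]; exact hST)
  let g : (H ⧸ S) →ₗ[A] (H ⧸ T) := g₀.restrictScalars A
  let f : N' →ₗ[A] (H ⧸ S) := N'.subtype.restrictScalars A
  have hg : Function.Surjective g := by
    intro y
    obtain ⟨h, rfl⟩ := Submodule.mkQ_surjective T y
    exact ⟨S.mkQ h, rfl⟩
  have hfg : Function.Exact f g := by
    intro y
    constructor
    · intro hy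
      obtain ⟨h, rfl⟩ := Submodule.mkQ_surjective S y
      have hh : h ∈ T := (Submodule.Quotient.mk_eq_zero T).1 hy
      exact ⟨⟨S.mkQ h, Submodule.mem_map_of_mem hh⟩, rfl⟩
    · rintro ⟨⟨y, hy⟩, rfl⟩
      obtain ⟨t, ht, rfl⟩ := hy
      exact (Submodule.Quotient.mk_eq_zero T).2 ht
  have hN'tors : ∀ x : N', a • x = 0 := by
    rintro ⟨x, hx⟩
    obtain ⟨t, ht, rfl⟩ := hx
    apply Subtype.ext
    show a • S.mkQ t = 0
    rw [Submodule.mkQ_apply, ← Submodule.Quotient.mk_smul, Submodule.Quotient.mk_eq_zero]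
    exact haT t ht
  haveI : Subsingleton (K ⊗[A] N') := subsingleton_baseChange_of_smul_eq_zero K ha hN'tors
  have hexact := lTensor_exact K hfg hg
  have hf0 : LinearMap.lTensor K f = 0 :=
    LinearMap.ext fun x => by rw [Subsingleton.elim x 0, map_zero, LinearMap.zero_apply]
  have hinj : Function.Injective (LinearMap.lTensor K g) := by
    rw [← LinearMap.ker_eq_bot, hexact.linearMap_ker_eq, hf0, LinearMap.range_zero]
  have hsurj : Function.Surjective (LinearMap.lTensor K g) := LinearMap.lTensor_surjective K hg
  have hbij : Function.Bijective (g.baseChange K) := by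
    rw [LinearMap.baseChange_eq_ltensor]
    exact ⟨hinj, hsurj⟩
  exact (LinearEquiv.ofBijective _ hbij).finrank_eq

/-- **(P-tie) in the kit's currency.**  If `a₁ • z₁ = a₂ • z₂` with `a₁, a₂ ∈ A` invertible in `K` (model:
`A = 𝒪`, `K = Frac 𝒪`, `Λ = 𝒪⟦X⟧`, `H = 𝐇¹_Γ(T_g)`, `z₁` the route's PUB class, `z₂` a print class `z_γ`), then
`dim_K (K ⊗_A 𝐇¹/Λz₁) = dim_K (K ⊗_A 𝐇¹/Λz₂)`: clause (ii) of the HOLD `KZ_g` transfers between them. -/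
theorem finrank_baseChange_quot_span_eq_of_smul_eq {z₁ z₂ : H} {a₁ a₂ : A}
    (h₁ : IsUnit (algebraMap A K a₁)) (h₂ : IsUnit (algebraMap A K a₂)) (h : a₁ • z₁ = a₂ • z₂) :
    finrank K (K ⊗[A] (H ⧸ Submodule.span Λ {z₁})) = finrank K (K ⊗[A] (H ⧸ Submodule.span Λ {z₂})) := by
  have key : ∀ (z : H) {a : A}, IsUnit (algebraMap A K a) →
      finrank K (K ⊗[A] (H ⧸ Submodule.span Λ {a • z})) = finrank K (K ⊗[A] (H ⧸ Submodule.span Λ {z})) := by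
    intro z a ha
    refine finrank_baseChange_quotient_eq_of_smul_mem K ?_ ha ?_
    · rw [Submodule.span_singleton_le_iff_mem, ← algebraMap_smul Λ a z]
      exact Submodule.smul_mem _ _ (Submodule.mem_span_singleton_self z)
    · intro t ht
      obtain ⟨r, rfl⟩ := Submodule.mem_span_singleton.1 ht
      rw [smul_comm]
      exact Submodule.smul_mem _ r (Submodule.mem_span_singleton_self _)
  rw [← key z₁ h₁, h, key z₂ h₂]

/-- **Tie-free ⇒ tied**: clause (ii) of `KZ_g` proved for a print class `z₂` gives clause (ii) for the route's
class `z₁` as soon as `a₁ • z₁ = a₂ • z₂` — the (P-tie) field of STUB-PLAN rev 5.2 §11 is discharged by this and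
`exists_smul_eq_of_anticomm`. -/
theorem clause_ii_transfer {z₁ z₂ : H} {a₁ a₂ : A} (h₁ : IsUnit (algebraMap A K a₁))
    (h₂ : IsUnit (algebraMap A K a₂)) (h : a₁ • z₁ = a₂ • z₂) {F₂ e : ℕ}
    (hii : finrank K (K ⊗[A] (H ⧸ Submodule.span Λ {z₂})) ≤ F₂ + e) :
    finrank K (K ⊗[A] (H ⧸ Submodule.span Λ {z₁})) ≤ F₂ + e := by
  rwa [finrank_baseChange_quot_span_eq_of_smul_eq K h₁ h₂ h]

end Currency

/-! ## §C  The `T = 0` pincer (PLAN 3, recorded with its obstruction) -/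

section Pincer

variable {A : Type*} [CommRing A] [IsDomain A]

open PowerSeries

/-- **Numerical-criterion shape** (Wiles–Lenstra pattern, transplanted to `A⟦X⟧`): if `F ∣ G` and the constant
terms divide the other way, `G(0) ∣ F(0) ≠ 0`, then `F` and `G` are associates (so `λ(F) = λ(G)`,
`μ(F) = μ(G)`).  The card explains why the divisibility half is cheap for `char X⁺_{S₀}(g)` but the constant-term
half is rank-0 BSD₂ for `g` — hence NOT a road for the ∀-stub. -/
theorem associated_of_dvd_of_constantCoeff_dvd {F G : A⟦X⟧} (h : F ∣ G)
    (h0 : constantCoeff G ∣ constantCoeff F) (hF0 : constantCoeff F ≠ 0) : Associated F G := by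
  obtain ⟨H, rfl⟩ := h
  obtain ⟨t, ht⟩ := h0
  rw [map_mul] at ht
  have h1 : constantCoeff F * (1 - constantCoeff H * t) = 0 := by
    linear_combination ht
  have h2 : 1 - constantCoeff H * t = 0 := (mul_eq_zero.1 h1).resolve_left hF0
  have hHt : constantCoeff H * t = 1 := by linear_combination (-1 : A) * h2
  have hH : IsUnit H := PowerSeries.isUnit_iff_constantCoeff.2 (isUnit_iff_exists_inv.2 ⟨t, hHt⟩)
  exact ⟨hH.unit, by simp⟩

end Pincer

end Summit.BirchSwinnertonDyer.BirchSwinnertonDyer.Cruxes.ResidualThetaCountLowerPureAtTwo.StubIdeasK2G5
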